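import Summits.CriticalPhenomena.PercolationContinuityZ3.Theorems.Transplant.Z3NetLayered
import Summits.CriticalPhenomena.PercolationContinuityZ3.Theorems.Transplant.PlanarSkeletonFrm1
import Summits.CriticalPhenomena.PercolationContinuityZ3.Theorems.Transplant.PlanarSkeletonFrmScaledDefs
import Summits.CriticalPhenomena.PercolationContinuityZ3.Theorems.Transplant.PlanarSkeletonFrmOfBase
import Mathlib.Tactic.FinCases
import HarnessLib

/-!
# Sharpness row 88: EVERY flat, linked, periodic net on `ℤ³` of planar range one is a MULTI-TYPE frames-only carrier (no symmetry asked), and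
# the CHIRAL SLAB NET `G₈₈` — three inhomogeneous vertex types, NOT vertex-transitive, no centred sign symmetry — carries NO one-type skeleton

builds on p205010 (kernel theorem, internal audit signed; external expert review pending) — nothing in this file uses p205010; NOTHING is claimed about any
open node (the multi-type frames-only node, `U` = `SamePDropOfSkeletonFrmFrom₁`, `U_s` = `SamePDropOfSkeletonFrmScaled₁`, the end-state node are OPEN `Prop`s of this
programme; in particular `θ(p_c) = 0` for `G₈₈` is NOT claimed and is not in print).
Lane `prim-bschramm`, seat `prim-bschramm-p5` gen 24 (refuter / sharpness seat; P5-SHARPNESS §54.5, examples-table row 88; class-B file authorised by lead g21's GO line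
2026-08-26 10:51Z (C)).  Helper file (`--supports stmt-CriticalPhenomena-4575 --as helper`).
* §1 `Z3Net.skeletonFrm` — the p2 device `SignData.skeletonSign` WITH BOTH SYMMETRY FIELDS DELETED: a net on `ℤ³` with flat square layers, linked consecutive layers, periods
  and planar range `≤ 1` carries a `PlanarSkeletonFrm` over `proj = (x₀, x₁)` with base vertices the residue box (frames = period-lattice translations, (ι) from the flat layers,
  (κ) from the linked columns, (μ) by periodicity).  Hence UNCONDITIONALLY every such net is connected, quasi-transitive and has `p_c ≤ ½` at every vertex
  (`Z3Net.conj4_hypotheses_of_flat`) — the whole family is a customer of the (untyped, OPEN) multi-type unit-step frames-only node / the end state's first layer; under the two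
  centred symmetries it is CLOSED by p2's `criticalContinuity_of_flat` (Sign node), without them nothing is claimed.
* §2 **`chiralNet` (`G₈₈`)**: `ℤ³` with all bonds `±e₀, ±e₁, ±e₂` and, out of the layers `x₂ ≡ 1 (mod 3)` only, the CHIRAL slanted rungs `{x, x + e₀ + e₂}` and
  `{x, x + e₀ + e₁ − e₂}`; flat, linked, periods `(1, 1, 3)`, planar range `1` ⟹ its three-type skeleton `chiralNet.skeleton` and the Conjecture-4 hypotheses.
* §3 **NOT vertex-transitive**: `degree (0,0,1) = 8 ≠ 7 = degree 0` (`degree_eq_card_stepsAt`), so no automorphism maps `0` to `(0,0,1)` and **no `PlanarSkeletonFrm`,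
  `PlanarSkeletonFrmScaled` or `PlanarSkeletonNeg` on `G₈₈` has a single base type** (`types_ne_singleton`, `typesScaled_ne_singleton`, `typesNeg_ne_singleton`): `G₈₈` is
  outside the reach of N1, N2, U and U_s — the first concrete carrier separating the multi-type first layer from every one-type node.
* §4 **No centred sign symmetry**: `chiralNet.SymmetricUnder ε → ε = 1` — every one of the seven non-trivial sign patterns of p2's device (central inversion / axis flips,
  any vertical sign) breaks one of the two slant families at the base site `(0,0,1)`; so the multi-type Sign device `SignData` does not apply either (desk: the affine
  automorphism group is the translation lattice `ℤ × ℤ × 3ℤ`; not claimed in the kernel beyond the centred maps).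
[cite: BenjaminiSchramm1996, Conj. 4; §2 (quasi-transitive graphs)] [cite: KozmaNitzan2024, §4 p. 16 (Lemma 8: the role of the lattice symmetries)]
[cite: GrimmettPercolation1999, §12.1 p. 349 (general lattices)] [cite: DuminilCopinSidoraviciusTassion2016, Thm. 1 (slabs need the symmetries of ℤ²)]
-/

noncomputable section

namespace Summit.CriticalPhenomena.PercolationContinuityZ3.Theorems.Transplant

open SimpleGraph Literature.Probability.LatticeModels Literature.Probability.Percolation
open Literature.Barriers.CriticalPhenomena (IsQuasiTransitive)
open Z3Diag (ev proj proj_add proj_sub)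

namespace Z3Net

variable (N : Z3Net)

/-! ## §1 Flat linked periodic nets of planar range one carry a multi-type `PlanarSkeletonFrm` (p2's device minus its two symmetry fields) -/

/-- **The degree equals the number of steps** (`x + ·` is injective). [folklore] -/
theorem degree_eq_card_stepsAt (x : Site 3) : N.graph.degree x = (N.stepsAt x).card := by
  rw [← card_neighborFinset_eq_degree, N.neighborFinset_eq, Finset.card_image_of_injective _ (add_right_injective x)]

/-- (lip) `proj` is 1-Lipschitz along the edges of a net of planar range `≤ 1`. [folklore] -/
theorem lip_of_planar (planar : ∀ x, ∀ s ∈ N.stepsAt x, |s 0| ≤ 1 ∧ |s 1| ≤ 1) {x y : Site 3} (h : N.graph.Adj x y) (i : Fin 2) :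
    |proj x i - proj y i| ≤ 1 := by
  obtain ⟨s, hs, rfl⟩ := (N.adj_iff_exists x y).1 h
  have hs' := planar x s hs
  fin_cases i
  · simpa [proj] using hs'.1
  · simpa [proj] using hs'.2

/-- (μ) The degree bound of a periodic net: the largest step count over the residue box. [folklore] -/
def ΔOf (n : Fin 3 → ℕ) : ℕ := (typesBox n).sup fun t => (N.stepsAt t).card

/-- Every vertex has degree `≤ ΔOf n` (periodicity). [folklore] -/
theorem degree_le_ΔOf {n : Fin 3 → ℕ} (periodic : N.Periodic n) (n_pos : ∀ i, 0 < n i) (x : Site 3) : N.graph.degree x ≤ N.ΔOf n := by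
  refine (N.degree_le x).trans ?_
  rw [← N.stepsAt_residue periodic x]
  exact Finset.le_sup (f := fun t => (N.stepsAt t).card) (residue_mem_typesBox n_pos x)

/-- **THE FRAMES-ONLY SKELETON OF A FLAT LINKED PERIODIC NET OF PLANAR RANGE ONE** (multi-type: base vertices = the residue box `∏ [0, nᵢ)`; frames = period-lattice
translations; (ι) the flat layers; (κ) the linked columns; (μ) periodicity; NO symmetry).  The p2 device `SignData.skeletonSign` with the fields `neg`/`flip` deleted.
[cite: KozmaNitzan2024, §4 p. 16 (Lemma 8)] [cite: BenjaminiSchramm1996, §2 (quasi-transitive graphs)] -/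
def skeletonFrm (hF : N.Flat) (hL : N.Linked) (n : Fin 3 → ℕ) (n_pos : ∀ i, 0 < n i) (periodic : N.Periodic n)
    (planar : ∀ x, ∀ s ∈ N.stepsAt x, |s 0| ≤ 1 ∧ |s 1| ≤ 1) : PlanarSkeletonFrm N.graph where
  φ := proj
  lip := fun _ _ h i => N.lip_of_planar planar h i
  types := typesBox n
  frame := fun v => by
    obtain ⟨t, ht, α, hαt, hα⟩ := N.exists_frame periodic n_pos v
    exact ⟨t, ht, α, hαt, fun w => by rw [hα, proj_add, proj_sub]⟩
  Δ := N.ΔOf n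
  degree_le := N.degree_le_ΔOf periodic n_pos
  step := fun v i σ => by
    obtain ⟨s, hs, hφ⟩ := unit_of_flat hF v i σ
    exact ⟨v + s, N.adj_add_of_mem hs, by rw [proj_add, hφ]⟩
  cyl_connected := fun t _ ℓ hℓ => col_connected_of_flat hF hL t ℓ hℓ

/-- The skeleton map is `proj`. [folklore] -/
@[simp] theorem skeletonFrm_φ (hF : N.Flat) (hL : N.Linked) (n : Fin 3 → ℕ) (n_pos : ∀ i, 0 < n i) (periodic : N.Periodic n)
    (planar : ∀ x, ∀ s ∈ N.stepsAt x, |s 0| ≤ 1 ∧ |s 1| ≤ 1) : (N.skeletonFrm hF hL n n_pos periodic planar).φ = proj := rfl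

/-- The base vertices are the residue box. [folklore] -/
@[simp] theorem skeletonFrm_types (hF : N.Flat) (hL : N.Linked) (n : Fin 3 → ℕ) (n_pos : ∀ i, 0 < n i) (periodic : N.Periodic n)
    (planar : ∀ x, ∀ s ∈ N.stepsAt x, |s 0| ≤ 1 ∧ |s 1| ≤ 1) : (N.skeletonFrm hF hL n n_pos periodic planar).types = typesBox n := rfl

/-- **The Conjecture-4 hypotheses hold UNCONDITIONALLY on every flat linked periodic net of planar range one**: connected, quasi-transitive, `p_c ≤ ½ < 1` at every
vertex — all from the frames-only skeleton (`PlanarSkeletonFrm.graph_connected / isQuasiTransitive / criticalProb_le_half`), no symmetry used.  (`θ(p_c) = 0` is NOT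
claimed: it is the OPEN multi-type frames-only node / end-state first layer on this family.) [cite: BenjaminiSchramm1996, Conj. 4; Thm. 1] -/
theorem conj4_hypotheses_of_flat (hF : N.Flat) (hL : N.Linked) (n : Fin 3 → ℕ) (n_pos : ∀ i, 0 < n i) (periodic : N.Periodic n)
    (planar : ∀ x, ∀ s ∈ N.stepsAt x, |s 0| ≤ 1 ∧ |s 1| ≤ 1) :
    N.graph.Connected ∧ IsQuasiTransitive N.graph ∧ ∀ v : Site 3, criticalProb N.graph v ≤ 1 / 2 :=
  ⟨(N.skeletonFrm hF hL n n_pos periodic planar).graph_connected 0, (N.skeletonFrm hF hL n n_pos periodic planar).isQuasiTransitive,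
    fun v => (N.skeletonFrm hF hL n n_pos periodic planar).criticalProb_le_half v⟩

end Z3Net

/-! ## §2 The chiral slab net `G₈₈` -/

namespace ChiralNet

/-- The six axis steps `±e₀, ±e₁, ±e₂` (at every site). [folklore] -/
def base : Finset (Site 3) := {![1, 0, 0], ![-1, 0, 0], ![0, 1, 0], ![0, -1, 0], ![0, 0, 1], ![0, 0, -1]}

/-- The chiral extra steps: out of a layer `x₂ ≡ 1 (mod 3)` the two slants `e₀ + e₂`, `e₀ + e₁ − e₂`; into it, their reverses from the layers `≡ 2` resp. `≡ 0`.
[this work] -/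
def extra (x : Site 3) : Finset (Site 3) :=
  if x 2 % 3 = 1 then {![1, 0, 1], ![1, 1, -1]} else if x 2 % 3 = 2 then {![-1, 0, -1]} else {![-1, -1, 1]}

/-- The steps of `G₈₈` at `x`. [this work] -/
def stepsAt (x : Site 3) : Finset (Site 3) := base ∪ extra x

/-- The three residues modulo `3`. [folklore] -/
theorem emod_three_cases (a : ℤ) : a % 3 = 0 ∨ a % 3 = 1 ∨ a % 3 = 2 := by omega

/-- Steps out of a layer `≡ 1`. [folklore] -/
theorem stepsAt_of_one {x : Site 3} (h : x 2 % 3 = 1) : stepsAt x = base ∪ {![1, 0, 1], ![1, 1, -1]} := by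
  simp [stepsAt, extra, h]

/-- Steps out of a layer `≡ 2`. [folklore] -/
theorem stepsAt_of_two {x : Site 3} (h : x 2 % 3 = 2) : stepsAt x = base ∪ {![-1, 0, -1]} := by
  simp [stepsAt, extra, h]

/-- Steps out of a layer `≡ 0`. [folklore] -/
theorem stepsAt_of_zero {x : Site 3} (h : x 2 % 3 = 0) : stepsAt x = base ∪ {![-1, -1, 1]} := by
  simp [stepsAt, extra, h]

/-- `0` is never a step. [folklore] -/
theorem zero_notMem_stepsAt (x : Site 3) : (0 : Site 3) ∉ stepsAt x := by
  rcases emod_three_cases (x 2) with h | h | h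
  · rw [stepsAt_of_zero h]; decide
  · rw [stepsAt_of_one h]; decide
  · rw [stepsAt_of_two h]; decide

/-- The base steps are symmetric. [folklore] -/
theorem neg_mem_base {s : Site 3} (hs : s ∈ base) : -s ∈ base := by
  revert s; decide

/-- The steps are symmetric: `s` at `x` is `−s` at `x + s` (the slants go `1 → 2`, `1 → 0` and back). [this work] -/
theorem neg_mem_stepsAt_add {x s : Site 3} (hs : s ∈ stepsAt x) : -s ∈ stepsAt (x + s) := by
  have hx2 : (x + s) 2 = x 2 + s 2 := rfl
  rcases emod_three_cases (x 2) with h | h | h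
  · rw [stepsAt_of_zero h, Finset.mem_union, Finset.mem_singleton] at hs
    rcases hs with hs | rfl
    · exact Finset.mem_union_left _ (neg_mem_base hs)
    · have h' : (x + ![-1, -1, 1] : Site 3) 2 % 3 = 1 := by
        rw [hx2]; simp only [Matrix.cons_val_two, Matrix.tail_cons, Matrix.head_cons]; omega
      rw [stepsAt_of_one h']; decide
  · rw [stepsAt_of_one h, Finset.mem_union, Finset.mem_insert, Finset.mem_singleton] at hs
    rcases hs with hs | rfl | rfl
    · exact Finset.mem_union_left _ (neg_mem_base hs)
    · have h' : (x + ![1, 0, 1] : Site 3) 2 % 3 = 2 := by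
        rw [hx2]; simp only [Matrix.cons_val_two, Matrix.tail_cons, Matrix.head_cons]; omega
      rw [stepsAt_of_two h']; decide
    · have h' : (x + ![1, 1, -1] : Site 3) 2 % 3 = 0 := by
        rw [hx2]; simp only [Matrix.cons_val_two, Matrix.tail_cons, Matrix.head_cons]; omega
      rw [stepsAt_of_zero h']; decide
  · rw [stepsAt_of_two h, Finset.mem_union, Finset.mem_singleton] at hs
    rcases hs with hs | rfl
    · exact Finset.mem_union_left _ (neg_mem_base hs)
    · have h' : (x + ![-1, 0, -1] : Site 3) 2 % 3 = 1 := by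
        rw [hx2]; simp only [Matrix.cons_val_two, Matrix.tail_cons, Matrix.head_cons]; omega
      rw [stepsAt_of_one h']; decide

end ChiralNet

/-- **`G₈₈`, THE CHIRAL SLAB NET**: `ℤ³` with all axis bonds and, out of the layers `x₂ ≡ 1 (mod 3)`, the slanted rungs `{x, x + e₀ + e₂}` and `{x, x + e₀ + e₁ − e₂}`
(P5-SHARPNESS §54.5, row 88; the `ℤ`-periodic form of `ℤ² × {0,1,2}` with chiral slants). [this work] -/
def chiralNet : Z3Net where
  stepsAt := ChiralNet.stepsAt
  zero_notMem := ChiralNet.zero_notMem_stepsAt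
  symm := fun _ _ hs => ChiralNet.neg_mem_stepsAt_add hs

namespace ChiralNet

/-- The steps of the net are `stepsAt`. [folklore] -/
@[simp] theorem net_stepsAt : chiralNet.stepsAt = stepsAt := rfl

/-- `eᵢ` as explicit vectors. [folklore] -/
theorem ev_eq : ev 0 = ![1, 0, 0] ∧ ev 1 = ![0, 1, 0] ∧ ev 2 = ![0, 0, 1] := by
  refine ⟨?_, ?_, ?_⟩ <;> ext j <;> fin_cases j <;> simp [ev]

/-- The axis steps are steps at every site. [folklore] -/
theorem base_subset_stepsAt (x : Site 3) : base ⊆ stepsAt x := Finset.subset_union_left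

/-- The layers are flat square lattices. [folklore] -/
theorem flat : chiralNet.Flat := fun x => by
  obtain ⟨h0, h1, -⟩ := ev_eq
  refine ⟨base_subset_stepsAt x ?_, base_subset_stepsAt x ?_, base_subset_stepsAt x ?_, base_subset_stepsAt x ?_⟩
  · rw [h0]; decide
  · rw [h0]; decide
  · rw [h1]; decide
  · rw [h1]; decide

/-- `x ∼ x + e₂` everywhere (vertical rungs at every site). [folklore] -/
theorem adj_add_ev_two (x : Site 3) : chiralNet.graph.Adj x (x + ev 2) :=
  chiralNet.adj_add_of_mem (base_subset_stepsAt x (by rw [ev_eq.2.2]; decide))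

/-- The layers are linked (by the vertical rung at the site itself). [folklore] -/
theorem linked : chiralNet.Linked := fun x =>
  ⟨x, x + ev 2, adj_add_ev_two x, rfl, by simp [ev], by simp, by simp, by simp [ev], by simp [ev]⟩

/-- Planar range one: every step moves `x₀`, `x₁` by at most one. [folklore] -/
theorem planar (x : Site 3) : ∀ s ∈ chiralNet.stepsAt x, |s 0| ≤ 1 ∧ |s 1| ≤ 1 := by
  rw [net_stepsAt]
  rcases emod_three_cases (x 2) with h | h | h
  · rw [stepsAt_of_zero h]; decide
  · rw [stepsAt_of_one h]; decide
  · rw [stepsAt_of_two h]; decide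

/-- Periods `(1, 1, 3)`: the steps depend on `x` only through `x₂ mod 3`. [folklore] -/
theorem periodic : chiralNet.Periodic ![1, 1, 3] := by
  intro x i
  rw [net_stepsAt]
  have key : (x + ((![1, 1, 3] : Fin 3 → ℕ) i : ℤ) • ev i) 2 % 3 = x 2 % 3 := by
    fin_cases i <;> simp [ev]
  unfold stepsAt extra
  rw [key]

/-- The periods are positive. [folklore] -/
theorem periods_pos : ∀ i : Fin 3, 0 < (![1, 1, 3] : Fin 3 → ℕ) i := by decide

/-- **THE THREE-TYPE FRAMES-ONLY SKELETON OF `G₈₈`** over `proj` (base vertices `(0,0,0), (0,0,1), (0,0,2)`; frames the translations by `ℤ × ℤ × 3ℤ`; NO symmetry).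
[cite: KozmaNitzan2024, §4 p. 16 (Lemma 8)] [cite: BenjaminiSchramm1996, §2] -/
def skeleton : PlanarSkeletonFrm chiralNet.graph := chiralNet.skeletonFrm flat linked ![1, 1, 3] periods_pos periodic planar

/-- **Conjecture-4 hypotheses for `G₈₈`, unconditionally**: connected, quasi-transitive, `p_c ≤ ½` everywhere (`θ(p_c) = 0` NOT claimed — row 88 is OPEN and not in print).
[cite: BenjaminiSchramm1996, Conj. 4; Thm. 1] -/
theorem conj4_hypotheses : chiralNet.graph.Connected ∧ IsQuasiTransitive chiralNet.graph ∧ ∀ v : Site 3, criticalProb chiralNet.graph v ≤ 1 / 2 :=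
  chiralNet.conj4_hypotheses_of_flat flat linked ![1, 1, 3] periods_pos periodic planar

/-! ## §3 `G₈₈` is NOT vertex-transitive: no one-type skeleton of any kind -/

/-- Degree `7` on the layers `≡ 0`. [this work] -/
theorem degree_zero : chiralNet.graph.degree (0 : Site 3) = 7 := by
  rw [chiralNet.degree_eq_card_stepsAt, net_stepsAt, stepsAt_of_zero (by decide)]; decide

/-- Degree `8` on the layers `≡ 1`. [this work] -/
theorem degree_layer_one : chiralNet.graph.degree (![0, 0, 1] : Site 3) = 8 := by
  rw [chiralNet.degree_eq_card_stepsAt, net_stepsAt, stepsAt_of_one (by decide)]; decide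

/-- **No automorphism maps `0` to `(0,0,1)`** (degrees `7 ≠ 8`): `G₈₈` is quasi-transitive but NOT vertex-transitive. [cite: BenjaminiSchramm1996, §2 (quasi-transitive graphs)] -/
theorem not_exists_iso_zero_layer_one : ¬ ∃ α : chiralNet.graph ≃g chiralNet.graph, α 0 = ![0, 0, 1] := by
  rintro ⟨α, hα⟩
  have h := degree_eq_of_iso α (0 : Site 3)
  rw [hα, degree_zero, degree_layer_one] at h
  exact absurd h (by decide)

/-- From transitive frames at ONE base vertex, an automorphism `0 ↦ (0,0,1)`. [folklore] -/
theorem exists_iso_of_oneType {t : Site 3} (frame : ∀ v : Site 3, ∃ α : chiralNet.graph ≃g chiralNet.graph, α t = v) :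
    ∃ α : chiralNet.graph ≃g chiralNet.graph, α 0 = ![0, 0, 1] := by
  obtain ⟨α₀, h₀⟩ := frame 0
  obtain ⟨α₁, h₁⟩ := frame ![0, 0, 1]
  refine ⟨α₀.symm.trans α₁, ?_⟩
  show α₁ (α₀.symm 0) = ![0, 0, 1]
  rw [← h₀, RelIso.symm_apply_apply, h₁]

/-- **No `PlanarSkeletonFrm` on `G₈₈` has a single base type** — `G₈₈` is outside the one-type frames-only node N2 (and U). [cite: BenjaminiSchramm1996, §2] -/
theorem types_ne_singleton (Φ : PlanarSkeletonFrm chiralNet.graph) (t : Site 3) : Φ.types ≠ {t} := by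
  intro h1
  refine not_exists_iso_zero_layer_one (exists_iso_of_oneType (t := t) fun v => ?_)
  obtain ⟨t', ht', α, hαt, -⟩ := Φ.frame v
  rw [h1, Finset.mem_singleton] at ht'
  subst ht'
  exact ⟨α, hαt⟩

/-- **No `PlanarSkeletonFrmScaled` on `G₈₈` has a single base type** — `G₈₈` is outside the scaled one-type node U_s as well. [cite: BenjaminiSchramm1996, §2] -/
theorem typesScaled_ne_singleton (Φ : PlanarSkeletonFrmScaled chiralNet.graph) (t : Site 3) : Φ.types ≠ {t} := by
  intro h1
  refine not_exists_iso_zero_layer_one (exists_iso_of_oneType (t := t) fun v => ?_)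
  obtain ⟨t', ht', α, hαt, -⟩ := Φ.frame v
  rw [h1, Finset.mem_singleton] at ht'
  subst ht'
  exact ⟨α, hαt⟩

/-- **No `PlanarSkeletonNeg` on `G₈₈` has a single base type** — outside the one-type `{±1}` node N1 too. [cite: BenjaminiSchramm1996, §2] -/
theorem typesNeg_ne_singleton (Φ : PlanarSkeletonNeg chiralNet.graph) (t : Site 3) : Φ.types ≠ {t} := fun h1 =>
  types_ne_singleton Φ.toFrm t (by rw [PlanarSkeletonNeg.toFrm_types, h1])

/-! ## §4 No centred sign symmetry: the p2 device does not apply to `G₈₈` -/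

/-- **Every centred sign symmetry of `G₈₈` is trivial**: for each of the seven sign patterns `ε ≠ 1` the device hypothesis `SymmetricUnder ε` fails at the centre `0`, the
site `(0,0,1)` and one of the two slants. [cite: KozmaNitzan2024, §4 p. 16 (Lemma 8: the role of the lattice symmetries)] -/
theorem eq_one_of_symmetricUnder {ε : Fin 3 → ℤˣ} (h : chiralNet.SymmetricUnder ε) : ε = 1 := by
  -- the two slants at `(0,0,1)`
  have hs₁ : (![1, 0, 1] : Site 3) ∈ chiralNet.stepsAt ![0, 0, 1] := by
    rw [net_stepsAt, stepsAt_of_one (by decide)]; decide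
  have hs₂ : (![1, 1, -1] : Site 3) ∈ chiralNet.stepsAt ![0, 0, 1] := by
    rw [net_stepsAt, stepsAt_of_one (by decide)]; decide
  have h₁ := h 0 ![0, 0, 1] _ hs₁
  have h₂ := h 0 ![0, 0, 1] _ hs₂
  rw [net_stepsAt] at h₁ h₂
  -- evaluate the eight sign patterns
  funext i
  rcases Int.units_eq_one_or (ε 0) with e0 | e0 <;> rcases Int.units_eq_one_or (ε 1) with e1 | e1 <;>
    rcases Int.units_eq_one_or (ε 2) with e2 | e2
  · fin_cases i <;> simp [e0, e1, e2]
  all_goals exfalso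
  all_goals
    have hε : ε = ![ε 0, ε 1, ε 2] := by funext j; fin_cases j <;> rfl
    rw [hε, e0, e1, e2] at h₁ h₂
    revert h₁ h₂
    simp only [Z3Net.refl, sub_zero, zero_add]
    decide

/-- **Corollary: `G₈₈` carries none of the device's centred symmetries** — neither the central inversion of the chart (`(−,−,±)`) nor an axis flip (`(+,−,±)`, `(−,+,±)`).
[cite: KozmaNitzan2024, §4 p. 16 (Lemma 8)] -/
theorem not_symmetricUnder {ε : Fin 3 → ℤˣ} (hε : ε ≠ 1) : ¬ chiralNet.SymmetricUnder ε := fun h => hε (eq_one_of_symmetricUnder h)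

end ChiralNet

end Summit.CriticalPhenomena.PercolationContinuityZ3.Theorems.Transplant

end
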